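import Summits.HodgeConjecture.HodgeConjecture.Theorems.Ring2WeilCoverageCMTypeSignParity
import Summits.HodgeConjecture.HodgeConjecture.Theorems.Ring2WeilCoverageCMTypeSetPairCount
import Literature.NumberTheory.ComplexMultiplication.CMTorusPolarizationType
import Literature.AlgebraicGeometry.ComplexMultiplication.CyclotomicCMTypeResidues
import HarnessLib

/-!
# Weil-type family coverage — the LATTICE-NORM TWIST: a lattice `𝔪` with `𝔪𝔪^ρ = (α)`, `α ∈ K₀`, carries a
# `Φ`-positive divisor of type `𝔣₀` iff the principal lattice `𝔬` carries a `Φ_α`-positive one, `Φ_α` = the CM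
# type `Φ` TWISTED at the places where `α < 0`; residue bookkeeping of the twist for `K = ℚ(ζₘ)`

research route conditional on HC_CM; not a corollary; Q11.4-sentence-2 already refuted in dim ≥ 3.

Ring 2, WEIL-TYPE FAMILY-COVERAGE CENSUS (`HOME/WEIL-FAMILY-COVERAGE.md` `## b01`, blocks b01.23 (A), b01.36–b01.39 «the
principal lattice class only (`h(ℚ(ζ₃₉)) = h(ℚ(ζ₅₆)) = 2`; the other class is NOT treated)», owner ring2-b01), part 42 of
the `Ring2WeilCoverage*` series — the engine that carries every verdict of parts 7–41 (all stated for Shimura's divisors of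
type `𝔣₀` on the PRINCIPAL lattice, `CMTypeLattice.IsOfType 1 ζ 𝔣₀`) to an ARBITRARY lattice `𝔪` whose norm to `K₀` is
principal, `𝔪𝔪^ρ = (α)` with `α ∈ K₀^×` (every lattice class when `h(K₀) = 1`):

* §1 `exists_twist`: for `α ∈ K₀^×` and a CM type `Φ` there is a CM type `Φ_α` with
  `φ ∈ Φ_α ↔ (φ ∈ Φ ∧ α^φ > 0) ∨ (φ̄ ∈ Φ ∧ α^φ < 0)` («`Φ` twisted at the places where `α < 0`»); `Φ_α = Φ` when
  `α ≫ 0` (`mem_twist_iff_of_pos`).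
* §2 `isOfType_iff_isOfType_one_mul`: `𝔪𝔪^ρ = (α)` ⇒ (`X_ζ` of type `𝔣₀` on `ℂ^Φ/D(𝔪)` iff `X_{αζ}` of type `𝔣₀` on
  `ℂ^{Φ'}/D(𝔬)`) — `ζ𝔡𝔪𝔪^ρ = (αζ)𝔡`.
* §3 **`exists_pos_isOfType_iff_twist` (THE TWIST PRINCIPLE)**: `𝔪𝔪^ρ = (α)`, `α^ρ = α ≠ 0` ⇒
  (`∃ ζ`, `ζ^ρ = −ζ`, `Im ζ^φ > 0` on `Φ`, `IsOfType 𝔪 ζ 𝔣₀`) **iff** (`∃ ζ'`, `ζ'^ρ = −ζ'`, `Im ζ'^φ > 0` on `Φ_α`,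
  `IsOfType 1 ζ' 𝔣₀`): `ζ' = αζ`, `Im (αζ)^φ = α^φ · Im ζ^φ`.
* §4 principal lattices: `𝔪 = (g)` ⇒ `𝔪𝔪^ρ = (g g^ρ)` with `g g^ρ ≫ 0`, so `Φ_{gg^ρ} = Φ` and the verdict of `𝔪` is
  the verdict of `𝔬` (`exists_pos_isOfType_iff_of_eq_spanSingleton`; Shimura §14.4 Prop. 7 for `𝔞 = (g)`).
* §5 residue bookkeeping for `K ⊇ ℚ(ζₘ)` cyclotomic (`σ_t : ζ ↦ 𝐞(t)`): if «`Re σ_t(α) < 0 ↔ N t`» for a residue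
  predicate `N`, then `N` is symmetric (`iff_neg_of_read`), the residue set of `Φ_α` is
  `S_{Φ_α} = {t ∈ S_Φ : ¬N t} ∪ {−t : t ∈ S_Φ, N t}` (`mem_residueFilter_twist_iff`), and for `C` symmetric and
  `N_odd` a CM-type set **`|S_{Φ_α} ∩ C ∩ N_odd| ≡ |S_Φ ∩ C ∩ N_odd| + |{t ∈ S_Φ ∩ C : N t}| (mod 2)`**
  (`card_twist_inter_inter_mod_two`); `two_mul_card_inter_eq`: a CM-type set meets a symmetric set of `2k` unit
  residues in exactly `k` points — so the correction term is the CONSTANT `|C ∩ A|/2`, `A = {N}`: the twisted counts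
  of parts 35–41 shift by a constant depending only on `(α, C)`, and a lattice class either repeats the principal
  verdict (`|C_± ∩ A|/2` both even) or FLIPS it.

HONEST FRAMING: torus-level statements about Shimura's divisors `X_ζ` (§14.3) on `ℂ^Φ/D(𝔪)`; elementary ideal algebra
and residue combinatorics; nothing here is a statement about Hodge classes, `W_K`, general members or HC; `HC_CM` is used
nowhere.  No `def`, no named fact, no `sorry`.  Parts 43/44 apply this at `M = 39, 56` to an explicit non-principal prime.

References: [cite: Shimura1998, §14.3 Prop. 4–5, pp. 103–104; §14.4 Prop. 7, p. 105]; census b01.23 (A) (seat-derived).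
-/

noncomputable section

open scoped nonZeroDivisors NumberField ComplexConjugate
open NumberField NumberField.ComplexEmbedding FractionalIdeal Complex Finset

namespace Summit.HodgeConjecture.Ring2WeilCoverage.LatticeNormTwist

open Literature.AlgebraicGeometry.Motives (CMType)
open Literature.AlgebraicGeometry.HodgeTheory (IsCMTypeSet)
open Literature.AlgebraicGeometry.ComplexMultiplication.CyclotomicCMType
open Literature.NumberTheory.ComplexMultiplication
open Literature.NumberTheory.ComplexMultiplication.CMTypeLattice
open Literature.NumberTheory.NumberFields
open Summit.HodgeConjecture.Ring2WeilCoverage.CMTypeSignParity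
open Summit.HodgeConjecture.Ring2WeilCoverage.CMTypeSetPairCount (coprime_val_neg)

variable {K : Type} [Field K] [NumberField K] [IsCMField K]

/-! ### §1 The CM type twisted by the signs of a real element -/

omit [NumberField K] [IsCMField K] in
/-- `Re φ̄(x) = Re φ(x)`.
research route conditional on HC_CM; not a corollary; Q11.4-sentence-2 already refuted in dim ≥ 3. [folklore] -/
theorem re_conjugate_apply (φ : K →+* ℂ) (x : K) : (conjugate φ x).re = (φ x).re := by
  rw [conjugate_coe_eq, Complex.conj_re]

/-- The real part of `α^φ` for a non-zero REAL `α` is either positive or negative.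
research route conditional on HC_CM; not a corollary; Q11.4-sentence-2 already refuted in dim ≥ 3. [folklore] -/
theorem re_pos_or_neg_of_real {α : K} (hα : IsCMField.complexConj K α = α) (h0 : α ≠ 0) (φ : K →+* ℂ) :
    0 < (φ α).re ∨ (φ α).re < 0 := by
  rcases lt_trichotomy 0 (φ α).re with h | h | h
  · exact Or.inl h
  · exact absurd h.symm (re_embedding_ne_zero_of_real hα h0 φ)
  · exact Or.inr h

/-- **The twisted CM type `Φ_α` exists**: for a CM type `Φ` and a non-zero `α ∈ K₀` (`α^ρ = α`) the set
`{φ : (φ ∈ Φ ∧ Re α^φ > 0) ∨ (φ̄ ∈ Φ ∧ Re α^φ < 0)}` — `Φ` with `φ` replaced by `φ̄` at every place where `α` is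
negative — is again a CM type (`Re α^{φ̄} = Re α^φ ≠ 0`).
research route conditional on HC_CM; not a corollary; Q11.4-sentence-2 already refuted in dim ≥ 3. [folklore] -/
theorem exists_twist (Φ : CMType K) {α : K} (hα : IsCMField.complexConj K α = α) (h0 : α ≠ 0) :
    ∃ Φ' : CMType K, ∀ φ : K →+* ℂ,
      φ ∈ Φ'.1 ↔ (φ ∈ Φ.1 ∧ 0 < (φ α).re) ∨ (conjugate φ ∈ Φ.1 ∧ (φ α).re < 0) := by
  refine ⟨⟨{φ | (φ ∈ Φ.1 ∧ 0 < (φ α).re) ∨ (conjugate φ ∈ Φ.1 ∧ (φ α).re < 0)}, fun φ => ?_⟩,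
    fun φ => Iff.rfl⟩
  have hcc : conjugate (conjugate φ) = φ := star_star φ
  simp only [Set.mem_setOf_eq, re_conjugate_apply, hcc]
  have hΦ := Φ.2 φ
  have hΦ' := Φ.2 (conjugate φ)
  rw [hcc] at hΦ'
  rcases re_pos_or_neg_of_real hα h0 φ with h | h
  · have hn : ¬ (φ α).re < 0 := fun h' => lt_asymm h h'
    simp only [h, hn, and_true, and_false, or_false]
    exact hΦ
  · have hn : ¬ 0 < (φ α).re := fun h' => lt_asymm h h'
    simp only [h, hn, and_true, and_false, false_or]
    exact hΦ'

omit [NumberField K] [IsCMField K] in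
/-- **`Φ_α = Φ` when `α ≫ 0`** (e.g. `α = g g^ρ`): no place is twisted.
research route conditional on HC_CM; not a corollary; Q11.4-sentence-2 already refuted in dim ≥ 3. [folklore] -/
theorem mem_twist_iff_of_pos (Φ Φ' : CMType K) {α : K}
    (hΦ' : ∀ φ : K →+* ℂ, φ ∈ Φ'.1 ↔ (φ ∈ Φ.1 ∧ 0 < (φ α).re) ∨ (conjugate φ ∈ Φ.1 ∧ (φ α).re < 0))
    (hpos : ∀ φ : K →+* ℂ, 0 < (φ α).re) (φ : K →+* ℂ) : φ ∈ Φ'.1 ↔ φ ∈ Φ.1 := by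
  rw [hΦ' φ]
  have h := hpos φ
  constructor
  · rintro (⟨h1, -⟩ | ⟨-, h2⟩)
    · exact h1
    · exact absurd h2 (fun h' => lt_asymm h h')
  · exact fun h1 => Or.inl ⟨h1, h⟩

/-! ### §2 The type is transported along `𝔪𝔪^ρ = (α)` -/

/-- **`X_ζ` has type `𝔣₀` on `ℂ^Φ/D(𝔪)` iff `X_{αζ}` has type `𝔣₀` on the principal lattice**, for a lattice `𝔪` with
`𝔪𝔪^ρ = (α)`: `ζ𝔡𝔪𝔪^ρ = (αζ)𝔡𝔬𝔬^ρ`.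
research route conditional on HC_CM; not a corollary; Q11.4-sentence-2 already refuted in dim ≥ 3. [cite: Shimura1998, §14.4 (4), p. 105] -/
theorem isOfType_iff_isOfType_one_mul (𝔪 : (FractionalIdeal (𝓞 K)⁰ K)ˣ) {α : K}
    (h𝔪 : (𝔪 : FractionalIdeal (𝓞 K)⁰ K) * (conjIdeal 𝔪 : FractionalIdeal (𝓞 K)⁰ K) = spanSingleton (𝓞 K)⁰ α)
    (ζ : K) (𝔣₀ : Ideal (𝓞 (maximalRealSubfield K))) :
    IsOfType 𝔪 ζ 𝔣₀ ↔ IsOfType 1 (α * ζ) 𝔣₀ := by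
  rw [isOfType_iff, isOfType_iff, Units.val_one, conjIdeal_one, Units.val_one, mul_one, mul_one, mul_assoc,
    h𝔪, ← spanSingleton_mul_spanSingleton]
  constructor <;> intro h <;> rw [h] <;> ring

/-- `αζ` is skew for `α` real and `ζ` skew.
research route conditional on HC_CM; not a corollary; Q11.4-sentence-2 already refuted in dim ≥ 3. [folklore] -/
theorem complexConj_mul_of_real_of_skew {α ζ : K} (hα : IsCMField.complexConj K α = α)
    (hζ : IsCMField.complexConj K ζ = -ζ) : IsCMField.complexConj K (α * ζ) = -(α * ζ) := by
  rw [map_mul, hα, hζ, mul_neg]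

/-- `Im (αζ)^φ = Re α^φ · Im ζ^φ` for `α` real.
research route conditional on HC_CM; not a corollary; Q11.4-sentence-2 already refuted in dim ≥ 3. [folklore] -/
theorem im_embedding_mul_of_real' {α : K} (hα : IsCMField.complexConj K α = α) (ζ : K) (φ : K →+* ℂ) :
    (φ (α * ζ)).im = (φ α).re * (φ ζ).im := by
  rw [map_mul, Complex.mul_im, im_embedding_eq_zero_of_complexConj_eq hα φ, zero_mul, add_zero]

/-! ### §3 The twist principle -/

/-- **THE TWIST PRINCIPLE.**  Let `𝔪` be a lattice with `𝔪𝔪^ρ = (α)`, `α ∈ K₀^×` (`α^ρ = α`, `α ≠ 0`), and `Φ_α` the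
CM type `Φ` twisted at the places where `α < 0` (§1).  Then `ℂ^Φ/D(𝔪)` carries a `Φ`-positive divisor `X_ζ` of type
`(K; Φ; 𝔣₀)` (`ζ^ρ = −ζ`, `Im ζ^φ > 0` on `Φ`, `𝔬𝔣₀ = ζ𝔡𝔪𝔪^ρ`) **iff** the principal lattice `ℂ^{Φ_α}/D(𝔬)` carries a
`Φ_α`-positive divisor of type `(K; Φ_α; 𝔣₀)`: `ζ ↦ αζ` (`Im (αζ)^φ = α^φ Im ζ^φ`; at a twisted place `φ̄ ∈ Φ` and both
factors are negative).  For `𝔣₀ = 𝔬₀`: `(ℂ^Φ/D(𝔪), ι)` is principally polarisable iff `(ℂ^{Φ_α}/D(𝔬), ι)` is.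
research route conditional on HC_CM; not a corollary; Q11.4-sentence-2 already refuted in dim ≥ 3. [cite: Shimura1998, §14.3 Prop. 4–5, pp. 103–104] -/
theorem exists_pos_isOfType_iff_twist (Φ Φ' : CMType K) {α : K} (hα : IsCMField.complexConj K α = α) (h0 : α ≠ 0)
    (hΦ' : ∀ φ : K →+* ℂ, φ ∈ Φ'.1 ↔ (φ ∈ Φ.1 ∧ 0 < (φ α).re) ∨ (conjugate φ ∈ Φ.1 ∧ (φ α).re < 0))
    (𝔪 : (FractionalIdeal (𝓞 K)⁰ K)ˣ)
    (h𝔪 : (𝔪 : FractionalIdeal (𝓞 K)⁰ K) * (conjIdeal 𝔪 : FractionalIdeal (𝓞 K)⁰ K) = spanSingleton (𝓞 K)⁰ α)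
    (𝔣₀ : Ideal (𝓞 (maximalRealSubfield K))) :
    (∃ ζ : K, IsCMField.complexConj K ζ = -ζ ∧ (∀ φ : Φ.1, 0 < (φ.1 ζ).im) ∧ IsOfType 𝔪 ζ 𝔣₀) ↔
      ∃ ζ' : K, IsCMField.complexConj K ζ' = -ζ' ∧ (∀ φ : Φ'.1, 0 < (φ.1 ζ').im) ∧ IsOfType 1 ζ' 𝔣₀ := by
  constructor
  · rintro ⟨ζ, hζ, hpos, hT⟩
    refine ⟨α * ζ, complexConj_mul_of_real_of_skew hα hζ, fun φ => ?_,
      (isOfType_iff_isOfType_one_mul 𝔪 h𝔪 ζ 𝔣₀).mp hT⟩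
    rw [im_embedding_mul_of_real' hα ζ φ.1]
    rcases (hΦ' φ.1).mp φ.2 with ⟨h1, h2⟩ | ⟨h1, h2⟩
    · exact mul_pos h2 (hpos ⟨φ.1, h1⟩)
    · have h3 : (φ.1 ζ).im < 0 := by
        have := hpos ⟨conjugate φ.1, h1⟩
        rw [im_conjugate_apply] at this
        linarith
      exact mul_pos_of_neg_of_neg h2 h3
  · rintro ⟨ζ', hζ', hpos, hT⟩
    have hζ : IsCMField.complexConj K (α⁻¹ * ζ') = -(α⁻¹ * ζ') :=
      complexConj_mul_of_real_of_skew (by rw [map_inv₀, hα]) hζ'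
    refine ⟨α⁻¹ * ζ', hζ, fun φ => ?_, ?_⟩
    · rw [im_embedding_mul_of_real' (by rw [map_inv₀, hα]) ζ' φ.1, map_inv₀]
      have hre0 : (φ.1 α).im = 0 := im_embedding_eq_zero_of_complexConj_eq hα φ.1
      have hinv : (φ.1 α)⁻¹.re = ((φ.1 α).re)⁻¹ := by
        rw [Complex.inv_re, Complex.normSq_apply, hre0, mul_zero, add_zero, div_mul_eq_div_div, div_self
          (re_embedding_ne_zero_of_real hα h0 φ.1), one_div]
      rw [hinv]
      rcases re_pos_or_neg_of_real hα h0 φ.1 with h | h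
      · exact mul_pos (inv_pos.mpr h) (hpos ⟨φ.1, (hΦ' φ.1).mpr (Or.inl ⟨φ.2, h⟩)⟩)
      · have hmem : conjugate φ.1 ∈ Φ'.1 :=
          (hΦ' _).mpr (Or.inr ⟨by rw [show conjugate (conjugate φ.1) = φ.1 from star_star _]; exact φ.2,
            by rwa [re_conjugate_apply]⟩)
        have h3 : (φ.1 ζ').im < 0 := by
          have := hpos ⟨conjugate φ.1, hmem⟩
          rw [im_conjugate_apply] at this
          linarith
        exact mul_pos_of_neg_of_neg (inv_lt_zero.mpr h) h3
    · rw [isOfType_iff_isOfType_one_mul 𝔪 h𝔪, ← mul_assoc, mul_inv_cancel₀ h0, one_mul]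
      exact hT

/-! ### §4 Principal lattices: `𝔪 = (g)` has `𝔪𝔪^ρ = (g g^ρ)`, `g g^ρ ≫ 0`, and the verdict of `𝔬` -/

/-- `(g)^ρ = (g^ρ)` and **`(g)(g)^ρ = (g g^ρ)`**.
research route conditional on HC_CM; not a corollary; Q11.4-sentence-2 already refuted in dim ≥ 3. [cite: Shimura1998, §14.4 Prop. 7, p. 105] -/
theorem mul_conjIdeal_eq_of_eq_spanSingleton (𝔪 : (FractionalIdeal (𝓞 K)⁰ K)ˣ) {g : K}
    (hg : (𝔪 : FractionalIdeal (𝓞 K)⁰ K) = spanSingleton (𝓞 K)⁰ g) :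
    (𝔪 : FractionalIdeal (𝓞 K)⁰ K) * (conjIdeal 𝔪 : FractionalIdeal (𝓞 K)⁰ K) =
      spanSingleton (𝓞 K)⁰ (g * IsCMField.complexConj K g) := by
  rw [CMTypeLattice.coe_conjIdeal, hg, AmbiguousClass.fracIdealAut_spanSingleton, spanSingleton_mul_spanSingleton]

/-- `g g^ρ` is real and positive at every embedding (`(g g^ρ)^φ = |g^φ|²`), `g ≠ 0`.
research route conditional on HC_CM; not a corollary; Q11.4-sentence-2 already refuted in dim ≥ 3. [folklore] -/
theorem real_and_pos_mul_complexConj {g : K} (hg : g ≠ 0) :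
    IsCMField.complexConj K (g * IsCMField.complexConj K g) = g * IsCMField.complexConj K g ∧
      ∀ φ : K →+* ℂ, 0 < (φ (g * IsCMField.complexConj K g)).re := by
  refine ⟨by rw [map_mul, IsCMField.complexConj_apply_apply, mul_comm], fun φ => ?_⟩
  rw [map_mul, IsCMField.complexEmbedding_complexConj, Complex.mul_conj, Complex.normSq_eq_norm_sq]
  norm_cast
  exact pow_pos (norm_pos_iff.mpr ((map_ne_zero_iff φ φ.injective).mpr hg)) 2

/-- **A PRINCIPAL lattice repeats the verdict of `𝔬`** (Prop. 7 for `𝔞 = (g)`): if `𝔪 = (g)` then `ℂ^Φ/D(𝔪)` carries a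
`Φ`-positive divisor of type `𝔣₀` iff `ℂ^Φ/D(𝔬)` does (`Φ_{gg^ρ} = Φ`).  Contrapositive use (parts 43/44): a lattice
whose verdict differs from the principal one at a single CM type is NOT principal.
research route conditional on HC_CM; not a corollary; Q11.4-sentence-2 already refuted in dim ≥ 3. [cite: Shimura1998, §14.4 Prop. 7, p. 105] -/
theorem exists_pos_isOfType_iff_of_eq_spanSingleton (Φ : CMType K) (𝔪 : (FractionalIdeal (𝓞 K)⁰ K)ˣ) {g : K}
    (hg0 : g ≠ 0) (hg : (𝔪 : FractionalIdeal (𝓞 K)⁰ K) = spanSingleton (𝓞 K)⁰ g)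
    (𝔣₀ : Ideal (𝓞 (maximalRealSubfield K))) :
    (∃ ζ : K, IsCMField.complexConj K ζ = -ζ ∧ (∀ φ : Φ.1, 0 < (φ.1 ζ).im) ∧ IsOfType 𝔪 ζ 𝔣₀) ↔
      ∃ ζ' : K, IsCMField.complexConj K ζ' = -ζ' ∧ (∀ φ : Φ.1, 0 < (φ.1 ζ').im) ∧ IsOfType 1 ζ' 𝔣₀ := by
  obtain ⟨hreal, hpos⟩ := real_and_pos_mul_complexConj (K := K) hg0
  have h0 : g * IsCMField.complexConj K g ≠ 0 :=
    mul_ne_zero hg0 ((map_ne_zero_iff _ (IsCMField.complexConj K).injective).mpr hg0)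
  obtain ⟨Φ', hΦ'⟩ := exists_twist Φ hreal h0
  rw [exists_pos_isOfType_iff_twist Φ Φ' hreal h0 hΦ' 𝔪 (mul_conjIdeal_eq_of_eq_spanSingleton 𝔪 hg) 𝔣₀]
  have hmem : ∀ φ, φ ∈ Φ'.1 ↔ φ ∈ Φ.1 := mem_twist_iff_of_pos Φ Φ' hΦ' hpos
  constructor
  · rintro ⟨ζ', h1, h2, h3⟩
    exact ⟨ζ', h1, fun φ => h2 ⟨φ.1, (hmem φ.1).mpr φ.2⟩, h3⟩
  · rintro ⟨ζ', h1, h2, h3⟩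
    exact ⟨ζ', h1, fun φ => h2 ⟨φ.1, (hmem φ.1).mp φ.2⟩, h3⟩

/-! ### §5 Residue bookkeeping of the twist for `K ⊇ ℚ(ζₘ)` -/

section Residues

variable {m : ℕ} [NeZero m] {ζ : K}

/-- `𝐞(t) = exp(2πi t/m) ∈ ℂ` (`ZMod.toCircle`). -/
local notation3 (prettyPrint := false) "𝐞 " t:max => ((ZMod.toCircle t : Circle) : ℂ)

/-- **A CM-type set meets a symmetric set of unit residues in exactly half of it**: `S` a CM-type set (`t ∈ S ↔ −t ∉ S`
on units), `D` a set of unit residues stable under `t ↦ −t` ⇒ `2·|S ∩ D| = |D|`.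
research route conditional on HC_CM; not a corollary; Q11.4-sentence-2 already refuted in dim ≥ 3. [folklore] -/
theorem two_mul_card_inter_eq {S D : Finset (ZMod m)} (hS : IsCMTypeSet m S)
    (hD : ∀ t ∈ D, t.val.Coprime m ∧ -t ∈ D) : 2 * (S ∩ D).card = D.card := by
  classical
  have hinj : Set.InjOn (fun t : ZMod m => -t) ↑(S ∩ D) := fun a _ b _ h => neg_injective h
  have hdisj : Disjoint (S ∩ D) ((S ∩ D).image fun t => -t) := by
    rw [Finset.disjoint_left]
    rintro t ht ht'
    obtain ⟨u, hu, rfl⟩ := Finset.mem_image.mp ht'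
    have huS := (Finset.mem_inter.mp hu).1
    exact ((hS.2 u (hS.1 u huS)).mp huS) (Finset.mem_inter.mp ht).1
  have hunion : (S ∩ D) ∪ (S ∩ D).image (fun t => -t) = D := by
    ext t
    simp only [Finset.mem_union, Finset.mem_inter, Finset.mem_image]
    constructor
    · rintro (⟨-, h⟩ | ⟨u, ⟨-, hu⟩, rfl⟩)
      · exact h
      · exact (hD u hu).2
    · intro ht
      by_cases hS' : t ∈ S
      · exact Or.inl ⟨hS', ht⟩
      · refine Or.inr ⟨-t, ⟨?_, (hD t ht).2⟩, neg_neg t⟩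
        by_contra hn
        exact hS' ((hS.2 t (hD t ht).1).mpr hn)
  calc 2 * (S ∩ D).card = (S ∩ D).card + ((S ∩ D).image fun t => -t).card := by
        rw [Finset.card_image_of_injOn hinj]; ring
    _ = ((S ∩ D) ∪ (S ∩ D).image fun t => -t).card := (Finset.card_union_of_disjoint hdisj).symm
    _ = D.card := by rw [hunion]

/-- **The twist in residues — pure bookkeeping.**  `S` a CM-type set, `S'` described on units by
`t ∈ S' ↔ (t ∈ S ∧ ¬N t) ∨ (−t ∈ S ∧ N t)` with `N` symmetric on units, `S' ⊆` units, `C` symmetric, `N_odd` a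
CM-type set.  Then **`|S' ∩ C ∩ N_odd| ≡ |S ∩ C ∩ N_odd| + |{t ∈ S ∩ C : N t}| (mod 2)`**:
`S' ∩ C ∩ N_odd = {t ∈ S ∩ C ∩ N_odd : ¬N t} ⊔ −{t ∈ S ∩ C : N t, t ∉ N_odd}`.
research route conditional on HC_CM; not a corollary; Q11.4-sentence-2 already refuted in dim ≥ 3. [folklore] -/
theorem card_inter_inter_mod_two_of_twist {S S' C Nodd : Finset (ZMod m)} {N : ZMod m → Prop} [DecidablePred N]
    (hS : IsCMTypeSet m S) (hS'u : ∀ t ∈ S', t.val.Coprime m)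
    (hS' : ∀ t : ZMod m, t.val.Coprime m → (t ∈ S' ↔ (t ∈ S ∧ ¬ N t) ∨ (-t ∈ S ∧ N t)))
    (hN : ∀ t : ZMod m, t.val.Coprime m → (N t ↔ N (-t))) (hC : ∀ t ∈ C, -t ∈ C) (hNodd : IsCMTypeSet m Nodd) :
    (S' ∩ C ∩ Nodd).card % 2 = ((S ∩ C ∩ Nodd).card + ((S ∩ C).filter N).card) % 2 := by
  classical
  set P := (S ∩ C ∩ Nodd).filter fun t => ¬ N t with hP
  set Q0 := ((S ∩ C).filter N).filter fun t => t ∉ Nodd with hQ0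
  set Q := Q0.image fun t : ZMod m => -t with hQ
  have hinj : Set.InjOn (fun t : ZMod m => -t) ↑Q0 := fun a _ b _ h => neg_injective h
  have hQcard : Q.card = Q0.card := Finset.card_image_of_injOn hinj
  -- the decomposition `S' ∩ C ∩ Nodd = P ⊔ Q`
  have hdecomp : S' ∩ C ∩ Nodd = P ∪ Q := by
    ext t
    simp only [hP, hQ, hQ0, Finset.mem_union, Finset.mem_filter, Finset.mem_inter, Finset.mem_image]
    constructor
    · rintro ⟨⟨htS', htC⟩, htN⟩
      have htu := hS'u t htS'
      rcases (hS' t htu).mp htS' with ⟨h1, h2⟩ | ⟨h1, h2⟩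
      · exact Or.inl ⟨⟨⟨h1, htC⟩, htN⟩, h2⟩
      · refine Or.inr ⟨-t, ⟨⟨⟨h1, hC t htC⟩, (hN t htu).mp h2⟩, (hNodd.2 t htu).mp htN⟩, neg_neg t⟩
    · rintro (⟨⟨⟨h1, htC⟩, htN⟩, h2⟩ | ⟨u, ⟨⟨⟨huS, huC⟩, huN⟩, huNodd⟩, rfl⟩)
      · exact ⟨⟨(hS' t (hS.1 t h1)).mpr (Or.inl ⟨h1, h2⟩), htC⟩, htN⟩
      · have huu := hS.1 u huS
        have hnu : (-u).val.Coprime m := coprime_val_neg huu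
        refine ⟨⟨(hS' (-u) hnu).mpr (Or.inr ⟨by rw [neg_neg]; exact huS, (hN u huu).mp huN⟩), hC u huC⟩, ?_⟩
        by_contra hc
        exact huNodd ((hNodd.2 u huu).mpr (by exact hc))
  have hdisj : Disjoint P Q := by
    rw [Finset.disjoint_left]
    intro t htP htQ
    simp only [hP, hQ, hQ0, Finset.mem_filter, Finset.mem_inter, Finset.mem_image] at htP htQ
    obtain ⟨u, ⟨⟨⟨huS, -⟩, -⟩, -⟩, rfl⟩ := htQ
    exact ((hS.2 u (hS.1 u huS)).mp huS) htP.1.1.1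
  have h1 : (S' ∩ C ∩ Nodd).card = P.card + Q0.card := by
    rw [hdecomp, Finset.card_union_of_disjoint hdisj, hQcard]
  have h2 : (S ∩ C ∩ Nodd).card = ((S ∩ C ∩ Nodd).filter N).card + P.card :=
    (Finset.card_filter_add_card_filter_not _).symm
  have h3 : ((S ∩ C).filter N).card = (((S ∩ C).filter N).filter fun t => t ∈ Nodd).card + Q0.card :=
    (Finset.card_filter_add_card_filter_not _).symm
  have h4 : (((S ∩ C).filter N).filter fun t => t ∈ Nodd) = (S ∩ C ∩ Nodd).filter N := by
    ext t; simp only [Finset.mem_filter, Finset.mem_inter]; tauto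
  rw [h4] at h3
  omega

omit [IsCMField K] in
/-- **The negativity predicate is symmetric**: if «`Re σ(α) < 0 ↔ N t`» whenever `σ ζ = 𝐞(t)` (`t` a unit), then
`N t ↔ N (−t)` on units — the conjugate embedding reads `−t` and has the same real part.
research route conditional on HC_CM; not a corollary; Q11.4-sentence-2 already refuted in dim ≥ 3. [folklore] -/
theorem iff_neg_of_read [IsCyclotomicExtension {m} ℚ K] (hζ : IsPrimitiveRoot ζ m) {α : K} {N : ZMod m → Prop}
    (hN : ∀ (σ : K →+* ℂ) (t : ZMod m), t.val.Coprime m → σ ζ = 𝐞 t → ((σ α).re < 0 ↔ N t))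
    (t : ZMod m) (ht : t.val.Coprime m) : N t ↔ N (-t) := by
  obtain ⟨σ, hσ⟩ := exists_embedding_apply_eq_toCircle hζ t ht
  rw [← hN σ t ht hσ, ← hN (conjugate σ) (-t) (coprime_val_neg ht) (conjugate_apply_eq_toCircle_neg hσ),
    re_conjugate_apply]

open scoped Classical in
/-- **The residue set of the twisted type**: for `Φ_α` as in §1 and «`Re σ(α) < 0 ↔ N t`» (`σ ζ = 𝐞(t)`), a unit residue
`t` lies in `S_{Φ_α}` iff (`t ∈ S_Φ` and `¬N t`) or (`−t ∈ S_Φ` and `N t`).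
research route conditional on HC_CM; not a corollary; Q11.4-sentence-2 already refuted in dim ≥ 3. [folklore] -/
theorem mem_residueFilter_twist_iff [IsCyclotomicExtension {m} ℚ K] (hζ : IsPrimitiveRoot ζ m) (Φ Φ' : CMType K)
    {α : K} (hα : IsCMField.complexConj K α = α) (h0 : α ≠ 0)
    (hΦ' : ∀ φ : K →+* ℂ, φ ∈ Φ'.1 ↔ (φ ∈ Φ.1 ∧ 0 < (φ α).re) ∨ (conjugate φ ∈ Φ.1 ∧ (φ α).re < 0))
    {N : ZMod m → Prop}
    (hN : ∀ (σ : K →+* ℂ) (t : ZMod m), t.val.Coprime m → σ ζ = 𝐞 t → ((σ α).re < 0 ↔ N t))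
    (t : ZMod m) (ht : t.val.Coprime m) :
    t ∈ (Finset.univ.filter fun s : ZMod m => ∃ σ ∈ Φ'.1, σ ζ = 𝐞 s) ↔
      (t ∈ (Finset.univ.filter fun s : ZMod m => ∃ σ ∈ Φ.1, σ ζ = 𝐞 s) ∧ ¬ N t) ∨
        (-t ∈ (Finset.univ.filter fun s : ZMod m => ∃ σ ∈ Φ.1, σ ζ = 𝐞 s) ∧ N t) := by
  obtain ⟨σ, hσ⟩ := exists_embedding_apply_eq_toCircle hζ t ht
  have hσc := conjugate_apply_eq_toCircle_neg hσ
  have hread : ∀ (Ψ : CMType K) (s : ZMod m) (τ : K →+* ℂ), τ ζ = 𝐞 s →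
      ((s ∈ Finset.univ.filter fun s : ZMod m => ∃ σ ∈ Ψ.1, σ ζ = 𝐞 s) ↔ τ ∈ Ψ.1) := fun Ψ s τ hτ => by
    simp only [Finset.mem_filter, Finset.mem_univ, true_and]
    exact ⟨fun ⟨σ', h1, h2⟩ => embedding_eq_of_apply_eq hζ (h2.trans hτ.symm) ▸ h1, fun h1 => ⟨τ, h1, hτ⟩⟩
  rw [hread Φ' t σ hσ, hread Φ t σ hσ, hread Φ (-t) (conjugate σ) hσc, hΦ' σ, ← hN σ t ht hσ]
  rcases re_pos_or_neg_of_real hα h0 σ with h | h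
  · have hn : ¬ (σ α).re < 0 := fun h' => lt_asymm h h'
    simp [h, hn]
  · have hn : ¬ 0 < (σ α).re := fun h' => lt_asymm h h'
    simp [h, hn]

open scoped Classical in
/-- **The twisted counts shift by `|{t ∈ S_Φ ∩ C : N t}|`**: for `Φ_α` as in §1, «`Re σ(α) < 0 ↔ N t`», `C` symmetric and
`N_odd` a CM-type set, `|S_{Φ_α} ∩ C ∩ N_odd| ≡ |S_Φ ∩ C ∩ N_odd| + |{t ∈ S_Φ ∩ C : N t}| (mod 2)`.  With
`two_mul_card_inter_eq` the shift is the constant `|{t ∈ C : N t}|/2`.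
research route conditional on HC_CM; not a corollary; Q11.4-sentence-2 already refuted in dim ≥ 3. [folklore] -/
theorem card_twist_inter_inter_mod_two [IsCyclotomicExtension {m} ℚ K] (hζ : IsPrimitiveRoot ζ m) (Φ Φ' : CMType K)
    {α : K} (hα : IsCMField.complexConj K α = α) (h0 : α ≠ 0)
    (hΦ' : ∀ φ : K →+* ℂ, φ ∈ Φ'.1 ↔ (φ ∈ Φ.1 ∧ 0 < (φ α).re) ∨ (conjugate φ ∈ Φ.1 ∧ (φ α).re < 0))
    {N : ZMod m → Prop} [DecidablePred N]
    (hN : ∀ (σ : K →+* ℂ) (t : ZMod m), t.val.Coprime m → σ ζ = 𝐞 t → ((σ α).re < 0 ↔ N t))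
    {C Nodd : Finset (ZMod m)} (hC : ∀ t ∈ C, -t ∈ C) (hNodd : IsCMTypeSet m Nodd) :
    ((Finset.univ.filter fun s : ZMod m => ∃ σ ∈ Φ'.1, σ ζ = 𝐞 s) ∩ C ∩ Nodd).card % 2 =
      (((Finset.univ.filter fun s : ZMod m => ∃ σ ∈ Φ.1, σ ζ = 𝐞 s) ∩ C ∩ Nodd).card +
        (((Finset.univ.filter fun s : ZMod m => ∃ σ ∈ Φ.1, σ ζ = 𝐞 s) ∩ C).filter N).card) % 2 := by
  have hS := isCMTypeSet_residueFilter hζ Φ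
  have hS' := isCMTypeSet_residueFilter hζ Φ'
  convert card_inter_inter_mod_two_of_twist (N := N) hS hS'.1
    (fun t ht => mem_residueFilter_twist_iff hζ Φ Φ' hα h0 hΦ' hN t ht) (iff_neg_of_read hζ hN) hC hNodd using 3

end Residues

end Summit.HodgeConjecture.Ring2WeilCoverage.LatticeNormTwist

end
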